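import Summits.Ventures.PercRepro.S1CoreCapSixZero
import Summits.Ventures.PercRepro.S1CoreCapSixOneFinal

/-!
# PercRepro — TOWARDS `Q*(6) = 16`: NO BIG LINE, A LINE WITH TWO FAT POINTS (p1, gen 25)

The remaining case without a line of `≥ 4` points: some 3-point line `A` carries two fat points (weight `5`,
cap `3`, cost `3`). Over `A` the other lines have the budget `free + fat (union) + 3 ≤ 8` of `S1CoreCapSixOne`
with `fat A = 2`, i.e. at most `3` free lines and at most one new fat point: a second line beside one with two
new fat points costs `2 + 4 + 3` (`card_le_one_of_two_new_fat`), two new fat points on distinct lines cost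
`2 + 4 + 3` (`not_two_new_fat_points`), and with at most one new fat point the bounds of
`bounds_of_one_new_fat` at `k = 3, k' = 1` give `#T + Σ deg ≤ 6 + 6`. Hence the cap sum is `≤ 3 + 12 = 15`
(`sum_cap_le_sixteen_of_heavy_three`), and with `S1CoreCapSixZero` every configuration of 3-point lines has cap
sum `≤ 16` (`sum_cap_le_sixteen_of_no_big`). `proofs/P1-S4-CAPBRIDGE.md` §17. Axioms: standard.
-/

namespace PercRepro

namespace S1

namespace FourCap

variable {β : Type} [DecidableEq β]

section ZeroHeavy

variable {w : β → ℕ} {ls : Finset (Finset β)}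
  (h1 : ∀ L ∈ ls, ∀ v ∈ L, w v = 1 ∨ w v = 2)
  (h2 : ∀ L ∈ ls, 3 ≤ L.card ∧ wsum w L ≤ 5)
  (h3 : ∀ L ∈ ls, ∀ L' ∈ ls, L ≠ L' → (L ∩ L').card ≤ 1)
  (h4 : ∀ l : List (Finset β), l.Nodup → (∀ L ∈ l, L ∈ ls) → wsum w (unionL l) ≤ 6 + lineRank l)
  (hall : ∀ L ∈ ls, L.card = 3)
  {A : Finset β} (hA : A ∈ ls) (fA : 2 ≤ fat w A)

omit [DecidableEq β] in
include h1 h2 hA fA hall in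
/-- `A` has exactly two fat points. -/
theorem fat_A_eq_two : fat w A = 2 := by
  have := wsum_eq_card_add_fat w A (h1 A hA)
  have := (h2 A hA).2
  have := hall A hA
  omega

include h1 h2 h3 h4 hall hA fA in
/-- **A line with two fat points off `A`** leaves room for no other line. -/
theorem card_le_one_of_two_new_fat {B : Finset β} (hB : B ∈ ls) (hBA : B ≠ A) (hf : 2 ≤ fat w (B \ A)) :
    (ls.erase A).card ≤ 1 := by
  have hrest : ∀ L ∈ ls, L ≠ A → L.card = 3 := fun L hL _ => hall L hL
  rw [Finset.card_le_one]
  intro Z hZ Z' hZ'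
  by_contra hne
  -- one of `Z, Z'` differs from `B`
  have key : ∀ Y ∈ ls.erase A, Y ≠ B → False := by
    intro Y hY hYB
    have hYls := (Finset.mem_erase.1 hY).2
    have hYA := (Finset.mem_erase.1 hY).1
    have hns := not_subset_union_A h3 hA hrest hYls hYA hB hYB
    have hnsB : ¬ B ⊆ A := fun hsub => by
      have hBU : B ∩ A = B := Finset.inter_eq_left.2 hsub
      have := h3 B hB A hA hBA
      rw [hBU] at this
      have := hall B hB
      omega
    have h := budget_one h1 h2 h4 hA hrest [Y, B] (by simp [hYB]) (by simp [hYls, hYA, hB, hBA])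
    simp only [freeCountR, unionLR, if_neg hns, if_neg hnsB] at h
    have hmono := fat_mono w (Finset.subset_union_right (s₁ := Y) (s₂ := B ∪ A))
    rw [fat_union_eq] at hmono
    have := fat_A_eq_two h1 h2 hall hA fA
    have := hall A hA
    omega
  by_cases hZB : Z = B
  · exact key Z' hZ' (fun h => hne (hZB.trans h.symm))
  · exact key Z hZ hZB

include h1 h2 h3 h4 hall hA fA in
/-- **Two new fat points on distinct lines** cost `2 + 4 + 3`. -/
theorem not_two_new_fat_points (hβ : ∀ B ∈ ls, B ≠ A → fat w (B \ A) ≤ 1) {q r : β}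
    (hqA : q ∉ A) (hrA : r ∉ A) (hq2 : w q = 2) (hr2 : w r = 2) (hqr : q ≠ r) {B C : Finset β}
    (hB : B ∈ ls) (hBA : B ≠ A) (hqB : q ∈ B) (hC : C ∈ ls) (hCA : C ≠ A) (hrC : r ∈ C) : False := by
  have hrest : ∀ L ∈ ls, L ≠ A → L.card = 3 := fun L hL _ => hall L hL
  have hnot : ∀ Z ∈ ls, Z ≠ A → q ∈ Z → r ∈ Z → False := by
    intro Z hZ hZA hqZ hrZ
    have := hβ Z hZ hZA
    have := two_le_fat (Finset.mem_sdiff.2 ⟨hqZ, hqA⟩) (Finset.mem_sdiff.2 ⟨hrZ, hrA⟩) hqr hq2 hr2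
    omega
  have hrB : r ∉ B := fun h => hnot B hB hBA hqB h
  have hBC : C ≠ B := fun h => hrB (h ▸ hrC)
  have hnsB : ¬ B ⊆ A := fun hsub => by
    have hBU : B ∩ A = B := Finset.inter_eq_left.2 hsub
    have := h3 B hB A hA hBA
    rw [hBU] at this
    have := hall B hB
    omega
  have h := budget_one h1 h2 h4 hA hrest [C, B] (by simp [hBC]) (by simp [hC, hCA, hB, hBA])
  rw [freeCountR_cons_of_new hrC hrA (fun L hL hrL => by
    simp only [List.mem_cons, List.not_mem_nil, or_false] at hL
    exact hrB (hL ▸ hrL))] at h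
  simp only [freeCountR, unionLR, if_neg hnsB] at h
  have hfat : fat w A + 2 ≤ fat w (C ∪ (B ∪ A)) := by
    have hsub : A.filter (fun v => w v = 2) ∪ {q, r} ⊆ (C ∪ (B ∪ A)).filter (fun v => w v = 2) := by
      intro u hu
      rcases Finset.mem_union.1 hu with h | h
      · exact Finset.mem_filter.2 ⟨by simp [(Finset.mem_filter.1 h).1], (Finset.mem_filter.1 h).2⟩
      · rcases Finset.mem_insert.1 h with rfl | h
        · exact Finset.mem_filter.2 ⟨by simp [hqB], hq2⟩
        · rw [Finset.mem_singleton.1 h]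
          exact Finset.mem_filter.2 ⟨by simp [hrC], hr2⟩
    have hdisj : Disjoint (A.filter (fun v => w v = 2)) {q, r} := by
      rw [Finset.disjoint_left]
      intro u hu hu'
      rcases Finset.mem_insert.1 hu' with rfl | hu'
      · exact hqA (Finset.mem_filter.1 hu).1
      · rw [Finset.mem_singleton.1 hu'] at hu
        exact hrA (Finset.mem_filter.1 hu).1
    have := Finset.card_le_card hsub
    rw [Finset.card_union_of_disjoint hdisj, Finset.card_pair hqr] at this
    exact this
  have := fat_A_eq_two h1 h2 hall hA fA
  have := hall A hA
  omega

include h1 h2 h3 h4 hall hA fA in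
/-- **A 3-point line with two fat points: cap sum `≤ 16`.** -/
theorem sum_cap_le_sixteen_of_heavy_three : ∑ L ∈ ls, capPaper L.card (fat w L) ≤ 16 := by
  have hrest : ∀ L ∈ ls, L ≠ A → L.card = 3 := fun L hL _ => hall L hL
  have hfA := fat_A_eq_two h1 h2 hall hA fA
  have hcA := hall A hA
  have hcapA : capPaper A.card (fat w A) = 3 := by rw [hcA, hfA]; decide
  set T := ls.erase A with hT
  have hTmem : ∀ Z ∈ T, Z ∈ ls ∧ Z ≠ A := fun Z hZ => ⟨(Finset.mem_erase.1 hZ).2, (Finset.mem_erase.1 hZ).1⟩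
  have hcap3 : ∀ Z ∈ T, capPaper Z.card (fat w Z) ≤ 3 := by
    intro Z hZ
    have := wsum_eq_card_add_fat w Z (h1 Z (hTmem Z hZ).1)
    have := (h2 Z (hTmem Z hZ).1).2
    have hk := hall Z (hTmem Z hZ).1
    rw [hk, capPaper_three_eq' (by omega)]
    omega
  rw [← Finset.add_sum_erase ls _ hA, ← hT, hcapA]
  by_cases hα : ∃ B ∈ ls, B ≠ A ∧ 2 ≤ fat w (B \ A)
  · obtain ⟨B, hB, hBA, hf⟩ := hα
    have hc := card_le_one_of_two_new_fat h1 h2 h3 h4 hall hA fA hB hBA hf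
    rw [← hT] at hc
    have hsum : ∑ Z ∈ T, capPaper Z.card (fat w Z) ≤ 3 * T.card := by
      calc ∑ Z ∈ T, capPaper Z.card (fat w Z) ≤ ∑ _Z ∈ T, 3 := Finset.sum_le_sum hcap3
        _ = 3 * T.card := by rw [Finset.card_eq_sum_ones, Finset.mul_sum]; simp only [mul_one]
    omega
  have hβ : ∀ B ∈ ls, B ≠ A → fat w (B \ A) ≤ 1 := fun B hB hBA => by
    by_contra hc
    exact hα ⟨B, hB, hBA, by omega⟩
  have hone : ∀ q r : β, q ∉ A → r ∉ A → w q = 2 → w r = 2 →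
      (∃ B ∈ ls, B ≠ A ∧ q ∈ B) → (∃ C ∈ ls, C ≠ A ∧ r ∈ C) → q = r := by
    intro q r hqA hrA hq2 hr2 ⟨B, hB, hBA, hqB⟩ ⟨C, hC, hCA, hrC⟩
    by_contra hne
    exact not_two_new_fat_points h1 h2 h3 h4 hall hA fA hβ hqA hrA hq2 hr2 hne hB hBA hqB hC hCA hrC
  rw [sum_cap_eq_card_add_sum_fat' (fun L hL => hrest L (hTmem L hL).1 (hTmem L hL).2)
      (fun L hL => h1 L (hTmem L hL).1) (fun L hL => (h2 L (hTmem L hL).1).2), sum_fat_eq_sum_deg,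
    ← Finset.sum_filter_add_sum_filter_not (fatPoints w T) (fun v => v ∈ A)]
  obtain ⟨hFA, hFN⟩ := bounds_of_one_new_fat h1 h2 h3 h4 hA hrest hone (k := 3) (k' := 1) (by omega) (by omega)
  rw [← hT] at hFA hFN
  rw [hfA] at hFA
  omega

end ZeroHeavy

section ZeroAll

variable {w : β → ℕ} {ls : Finset (Finset β)}
  (h1 : ∀ L ∈ ls, ∀ v ∈ L, w v = 1 ∨ w v = 2)
  (h2 : ∀ L ∈ ls, 3 ≤ L.card ∧ wsum w L ≤ 5)
  (h3 : ∀ L ∈ ls, ∀ L' ∈ ls, L ≠ L' → (L ∩ L').card ≤ 1)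
  (h4 : ∀ l : List (Finset β), l.Nodup → (∀ L ∈ l, L ∈ ls) → wsum w (unionL l) ≤ 6 + lineRank l)
  (hall : ∀ L ∈ ls, L.card = 3)

include h1 h2 h3 h4 hall in
/-- **No big line: cap sum `≤ 16`** — a line with two fat points, or every line of weight `≤ 4`. -/
theorem sum_cap_le_sixteen_of_no_big : ∑ L ∈ ls, capPaper L.card (fat w L) ≤ 16 := by
  by_cases hh : ∃ A ∈ ls, 2 ≤ fat w A
  · obtain ⟨A, hA, fA⟩ := hh
    exact sum_cap_le_sixteen_of_heavy_three h1 h2 h3 h4 hall hA fA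
  · refine sum_cap_le_sixteen_of_thin h1 h2 h3 h4 hall (fun L hL => ?_)
    have := wsum_eq_card_add_fat w L (h1 L hL)
    have := hall L hL
    have : fat w L ≤ 1 := by
      by_contra hc
      exact hh ⟨L, hL, by omega⟩
    omega

end ZeroAll

end FourCap

end S1

end PercRepro
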